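import Mathlib
import Summits.Ventures.PercRepro2.Defs
import Summits.Ventures.PercRepro2.Harris
import Summits.Ventures.PercRepro2.Graph
import Summits.Ventures.PercRepro2.Events

/-!
# (Ψ) from the one-edge pinning property, by induction on the unpinned edges (PercRepro2, p2)

For the (Ψ) inequality of the (PM⁺) line (P2-G16-GENSUB.md §1.9, `psi_of_psiSub`'s consequent;
P2-G17-PSI.md §0) write its SLACK, multiplied out in the tree's vocabulary,

  `Σ_𝓤(p) := Ug·((q − aH)·oL + q·(oLH + oHH) − aH·oH) − oLU·q²`

(`q = P(Q)`, `oL = P(o ∈ C_t, Q)`, `oH = P(o ∈ C_s, Q)`, `aH = P(u ∈ C_s, Q)`,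
`oLH = P(u ∈ C_s, o ∈ C_t, Q)`, `oHH = P(u ∈ C_s, o ∈ C_s, Q)`, `Ug = P(C_s ∈ 𝓤, Q)`,
`oLU = P(C_s ∈ 𝓤, o ∈ C_t, Q)`, all under the weight vector `p`); (Ψ)_𝓤 is `0 ≤ Σ_𝓤(p)`.
Along the pinning of ONE edge `f` (`w = p f`, everything else fixed) the eight masses are affine
in `w` (`prob_eq_pin`) and `Σ_𝓤` is a cubic in `w`.  Call an edge `e` UNPINNED for `p` when
`p e ∉ {0, 1}`, and (UNI_f) the one-edge property

  `min (Σ_𝓤(p[f↦0])) (Σ_𝓤(p[f↦1])) ≤ Σ_𝓤(p)`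

(P2-G17-PSI.md §6: census-true for every edge of every instance tested, with a log-concave
Bernstein sequence; proved for pendant edges in `PsiPendant.lean` / `PsiPendantCond.lean`).

* `psiPin_prob_eq_indicator` — a fully pinned weight vector is a point mass at `ω₀ = (e ↦ [p e = 1])`:
  `P_p(A) = 1[ω₀ ∈ A]`;
* `psiPin_slack_eq_zero` — for a point mass the slack vanishes (every mass is an
  indicator and the cubic collapses identically);
* `psi_slack_nonneg_of_uni` — **(Ψ) from (UNI)**: if every admissible weight vector with an
  unpinned edge has SOME unpinned edge `f` satisfying (UNI_f), then `0 ≤ Σ_𝓤(p)` for every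
  admissible `p` — strong induction on the number of unpinned edges.

So the conjecture (Ψ) is reduced, in the kernel, to the one-edge statement (UNI) — the
exploration lens edge by edge; choosing the edges at the explored `t`-cluster is allowed (the
hypothesis only asks for SOME unpinned edge per instance).
-/

namespace Summit.Ventures.PercRepro2

section PointMass

variable {V : Type*} {E : Type*} [Fintype E] [DecidableEq E] {R : Type*} [CommRing R]
  [LinearOrder R] [IsStrictOrderedRing R]

omit [DecidableEq E] in
/-- For a fully pinned weight vector the weight is the point mass at `(fun e => decide (p e = 1) : Config E)`. -/
lemma psiPin_weight_eq_ite {p : E → R} (h01 : ∀ e, p e = 0 ∨ p e = 1) (ω : Config E) :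
    weight p ω = if ω = (fun e => decide (p e = 1) : Config E) then 1 else 0 := by
  by_cases hω : ω = (fun e => decide (p e = 1) : Config E)
  · subst hω
    simp only [if_true]
    unfold weight
    refine Finset.prod_eq_one fun e _ => ?_
    rcases h01 e with h | h
    · simp [edgeFactor, h]
    · simp [edgeFactor, h]
  · simp only [hω, if_false]
    unfold weight
    obtain ⟨e, he⟩ := Function.ne_iff.1 hω
    refine Finset.prod_eq_zero (Finset.mem_univ e) ?_
    rcases h01 e with h | h
    · have : decide (p e = 1) = false := by simp [h]
      rw [this] at he
      have hωe : ω e = true := by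
        cases hωe : ω e
        · exact absurd hωe he
        · rfl
      simp [edgeFactor, hωe, h]
    · have : decide (p e = 1) = true := by simp [h]
      rw [this] at he
      have hωe : ω e = false := by
        cases hωe : ω e
        · rfl
        · exact absurd hωe he
      simp [edgeFactor, hωe, h]

/-- For a fully pinned weight vector, `P_p(A) = 1[(fun e => decide (p e = 1) : Config E) ∈ A]`. -/
lemma psiPin_prob_eq_indicator {p : E → R} (h01 : ∀ e, p e = 0 ∨ p e = 1)
    (A : Set (Config E)) : prob p A = A.indicator 1 ((fun e => decide (p e = 1) : Config E)) := by
  classical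
  unfold prob
  rw [Finset.sum_eq_single ((fun e => decide (p e = 1) : Config E))]
  · by_cases hA : (fun e => decide (p e = 1) : Config E) ∈ A
    · simp [Set.indicator_of_mem hA, psiPin_weight_eq_ite h01]
    · simp [Set.indicator_of_notMem hA]
  · intro ω _ hω
    by_cases hA : ω ∈ A
    · simp [Set.indicator_of_mem hA, psiPin_weight_eq_ite h01, hω]
    · simp [Set.indicator_of_notMem hA]
  · intro h
    exact absurd (Finset.mem_univ _) h

end PointMass

section PinInduction

variable {V : Type*} {E : Type*} [Fintype E] [DecidableEq E]
  {R : Type*} [CommRing R] [LinearOrder R] [IsStrictOrderedRing R]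

/-- For a point mass the (Ψ)-slack vanishes identically. -/
lemma psiPin_slack_eq_zero (p : E → R) (h01 : ∀ e, p e = 0 ∨ p e = 1)
    (ends : E → Sym2 V) (s t o u : V) (𝓤 : Set (Set V)) :
    (prob p (clusterInEvent ends s 𝓤 ∩ (connEvent ends s t)ᶜ) *
        ((prob p (connEvent ends s t)ᶜ - prob p (connEvent ends s u ∩ (connEvent ends s t)ᶜ)) *
            prob p (clusterInEvent ends t {W : Set V | o ∈ W} ∩ (connEvent ends s t)ᶜ) +
          prob p (connEvent ends s t)ᶜ *
            (prob p (connEvent ends s u ∩ clusterInEvent ends t {W : Set V | o ∈ W} ∩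
          (connEvent ends s t)ᶜ) +
              prob p (connEvent ends s u ∩ clusterInEvent ends s {W : Set V | o ∈ W} ∩
          (connEvent ends s t)ᶜ)) -
          prob p (connEvent ends s u ∩ (connEvent ends s t)ᶜ) *
            prob p (clusterInEvent ends s {W : Set V | o ∈ W} ∩ (connEvent ends s t)ᶜ)) -
      prob p (clusterInEvent ends s 𝓤 ∩ clusterInEvent ends t {W : Set V | o ∈ W} ∩
          (connEvent ends s t)ᶜ) * prob p (connEvent ends s t)ᶜ * prob p (connEvent ends s t)ᶜ) = 0 := by
  classical
  rw [psiPin_prob_eq_indicator h01, psiPin_prob_eq_indicator h01,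
    psiPin_prob_eq_indicator h01, psiPin_prob_eq_indicator h01,
    psiPin_prob_eq_indicator h01, psiPin_prob_eq_indicator h01,
    psiPin_prob_eq_indicator h01, psiPin_prob_eq_indicator h01]
  simp only [Set.indicator_apply, Set.mem_inter_iff, Set.mem_compl_iff, Pi.one_apply]
  by_cases h1 : (fun e => decide (p e = 1) : Config E) ∈ clusterInEvent ends s 𝓤 <;>
  by_cases h2 : (fun e => decide (p e = 1) : Config E) ∈ clusterInEvent ends t {W : Set V | o ∈ W} <;>
  by_cases h3 : (fun e => decide (p e = 1) : Config E) ∈ clusterInEvent ends s {W : Set V | o ∈ W} <;>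
  by_cases h4 : (fun e => decide (p e = 1) : Config E) ∈ connEvent ends s u <;>
  by_cases h5 : (fun e => decide (p e = 1) : Config E) ∈ connEvent ends s t <;>
  simp [h1, h2, h3, h4, h5]

/-- The unpinned edges of `p[f↦c]` (`c ∈ {0, 1}`) are those of `p` minus `f`. -/
lemma psiPin_filter_unpinned_update (p : E → R) (f : E) (c : R) (hc : c = 0 ∨ c = 1) :
    (Finset.univ.filter fun e => Function.update p f c e ≠ 0 ∧ Function.update p f c e ≠ 1) =
      (Finset.univ.filter fun e => p e ≠ 0 ∧ p e ≠ 1).erase f := by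
  ext e
  simp only [Finset.mem_filter, Finset.mem_univ, true_and, Finset.mem_erase]
  by_cases hef : e = f
  · subst hef
    simp only [Function.update_self, ne_eq, not_true_eq_false, false_and, iff_false]
    rcases hc with h | h <;> simp [h]
  · simp [hef]

/-- **(Ψ) from the one-edge pinning property (UNI).** If every admissible weight vector with an
unpinned edge has some unpinned edge `f` with `min (Σ_𝓤(p[f↦0])) (Σ_𝓤(p[f↦1])) ≤ Σ_𝓤(p)`, then
`0 ≤ Σ_𝓤(p)` for every admissible `p`: induction on the number of unpinned edges, the base case
being the point mass (`psiPin_slack_eq_zero`). -/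
theorem psi_slack_nonneg_of_uni (ends : E → Sym2 V) (s t o u : V) (𝓤 : Set (Set V))
    (huni : ∀ p : E → R, IsProbVec p → (∃ e, p e ≠ 0 ∧ p e ≠ 1) →
      ∃ f, p f ≠ 0 ∧ p f ≠ 1 ∧
        min (prob (Function.update p f 0) (clusterInEvent ends s 𝓤 ∩ (connEvent ends s t)ᶜ) *
        ((prob (Function.update p f 0) (connEvent ends s t)ᶜ - prob (Function.update p f 0) (connEvent ends s u ∩ (connEvent ends s t)ᶜ)) *
            prob (Function.update p f 0) (clusterInEvent ends t {W : Set V | o ∈ W} ∩ (connEvent ends s t)ᶜ) +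
          prob (Function.update p f 0) (connEvent ends s t)ᶜ *
            (prob (Function.update p f 0) (connEvent ends s u ∩ clusterInEvent ends t {W : Set V | o ∈ W} ∩
          (connEvent ends s t)ᶜ) +
              prob (Function.update p f 0) (connEvent ends s u ∩ clusterInEvent ends s {W : Set V | o ∈ W} ∩
          (connEvent ends s t)ᶜ)) -
          prob (Function.update p f 0) (connEvent ends s u ∩ (connEvent ends s t)ᶜ) *
            prob (Function.update p f 0) (clusterInEvent ends s {W : Set V | o ∈ W} ∩ (connEvent ends s t)ᶜ)) -
      prob (Function.update p f 0) (clusterInEvent ends s 𝓤 ∩ clusterInEvent ends t {W : Set V | o ∈ W} ∩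
          (connEvent ends s t)ᶜ) * prob (Function.update p f 0) (connEvent ends s t)ᶜ * prob (Function.update p f 0) (connEvent ends s t)ᶜ) (prob (Function.update p f 1) (clusterInEvent ends s 𝓤 ∩ (connEvent ends s t)ᶜ) *
        ((prob (Function.update p f 1) (connEvent ends s t)ᶜ - prob (Function.update p f 1) (connEvent ends s u ∩ (connEvent ends s t)ᶜ)) *
            prob (Function.update p f 1) (clusterInEvent ends t {W : Set V | o ∈ W} ∩ (connEvent ends s t)ᶜ) +
          prob (Function.update p f 1) (connEvent ends s t)ᶜ *
            (prob (Function.update p f 1) (connEvent ends s u ∩ clusterInEvent ends t {W : Set V | o ∈ W} ∩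
          (connEvent ends s t)ᶜ) +
              prob (Function.update p f 1) (connEvent ends s u ∩ clusterInEvent ends s {W : Set V | o ∈ W} ∩
          (connEvent ends s t)ᶜ)) -
          prob (Function.update p f 1) (connEvent ends s u ∩ (connEvent ends s t)ᶜ) *
            prob (Function.update p f 1) (clusterInEvent ends s {W : Set V | o ∈ W} ∩ (connEvent ends s t)ᶜ)) -
      prob (Function.update p f 1) (clusterInEvent ends s 𝓤 ∩ clusterInEvent ends t {W : Set V | o ∈ W} ∩
          (connEvent ends s t)ᶜ) * prob (Function.update p f 1) (connEvent ends s t)ᶜ * prob (Function.update p f 1) (connEvent ends s t)ᶜ) ≤ (prob p (clusterInEvent ends s 𝓤 ∩ (connEvent ends s t)ᶜ) *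
        ((prob p (connEvent ends s t)ᶜ - prob p (connEvent ends s u ∩ (connEvent ends s t)ᶜ)) *
            prob p (clusterInEvent ends t {W : Set V | o ∈ W} ∩ (connEvent ends s t)ᶜ) +
          prob p (connEvent ends s t)ᶜ *
            (prob p (connEvent ends s u ∩ clusterInEvent ends t {W : Set V | o ∈ W} ∩
          (connEvent ends s t)ᶜ) +
              prob p (connEvent ends s u ∩ clusterInEvent ends s {W : Set V | o ∈ W} ∩
          (connEvent ends s t)ᶜ)) -
          prob p (connEvent ends s u ∩ (connEvent ends s t)ᶜ) *
            prob p (clusterInEvent ends s {W : Set V | o ∈ W} ∩ (connEvent ends s t)ᶜ)) -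
      prob p (clusterInEvent ends s 𝓤 ∩ clusterInEvent ends t {W : Set V | o ∈ W} ∩
          (connEvent ends s t)ᶜ) * prob p (connEvent ends s t)ᶜ * prob p (connEvent ends s t)ᶜ)) :
    ∀ p : E → R, IsProbVec p → 0 ≤ (prob p (clusterInEvent ends s 𝓤 ∩ (connEvent ends s t)ᶜ) *
        ((prob p (connEvent ends s t)ᶜ - prob p (connEvent ends s u ∩ (connEvent ends s t)ᶜ)) *
            prob p (clusterInEvent ends t {W : Set V | o ∈ W} ∩ (connEvent ends s t)ᶜ) +
          prob p (connEvent ends s t)ᶜ *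
            (prob p (connEvent ends s u ∩ clusterInEvent ends t {W : Set V | o ∈ W} ∩
          (connEvent ends s t)ᶜ) +
              prob p (connEvent ends s u ∩ clusterInEvent ends s {W : Set V | o ∈ W} ∩
          (connEvent ends s t)ᶜ)) -
          prob p (connEvent ends s u ∩ (connEvent ends s t)ᶜ) *
            prob p (clusterInEvent ends s {W : Set V | o ∈ W} ∩ (connEvent ends s t)ᶜ)) -
      prob p (clusterInEvent ends s 𝓤 ∩ clusterInEvent ends t {W : Set V | o ∈ W} ∩
          (connEvent ends s t)ᶜ) * prob p (connEvent ends s t)ᶜ * prob p (connEvent ends s t)ᶜ) := by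
  suffices key : ∀ n : ℕ, ∀ p : E → R, IsProbVec p →
      (Finset.univ.filter fun e => p e ≠ 0 ∧ p e ≠ 1).card = n → 0 ≤ (prob p (clusterInEvent ends s 𝓤 ∩ (connEvent ends s t)ᶜ) *
        ((prob p (connEvent ends s t)ᶜ - prob p (connEvent ends s u ∩ (connEvent ends s t)ᶜ)) *
            prob p (clusterInEvent ends t {W : Set V | o ∈ W} ∩ (connEvent ends s t)ᶜ) +
          prob p (connEvent ends s t)ᶜ *
            (prob p (connEvent ends s u ∩ clusterInEvent ends t {W : Set V | o ∈ W} ∩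
          (connEvent ends s t)ᶜ) +
              prob p (connEvent ends s u ∩ clusterInEvent ends s {W : Set V | o ∈ W} ∩
          (connEvent ends s t)ᶜ)) -
          prob p (connEvent ends s u ∩ (connEvent ends s t)ᶜ) *
            prob p (clusterInEvent ends s {W : Set V | o ∈ W} ∩ (connEvent ends s t)ᶜ)) -
      prob p (clusterInEvent ends s 𝓤 ∩ clusterInEvent ends t {W : Set V | o ∈ W} ∩
          (connEvent ends s t)ᶜ) * prob p (connEvent ends s t)ᶜ * prob p (connEvent ends s t)ᶜ) by
    intro p hp
    exact key _ p hp rfl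
  intro n
  induction n with
  | zero =>
    intro p hp hcard
    have h01 : ∀ e, p e = 0 ∨ p e = 1 := by
      intro e
      by_contra hne
      have hne' : p e ≠ 0 ∧ p e ≠ 1 := ⟨fun h => hne (Or.inl h), fun h => hne (Or.inr h)⟩
      have : e ∈ (Finset.univ.filter fun e => p e ≠ 0 ∧ p e ≠ 1) := by
        simp [hne'.1, hne'.2]
      rw [Finset.card_eq_zero.1 hcard] at this
      exact absurd this (Finset.notMem_empty e)
    rw [psiPin_slack_eq_zero p h01 ends s t o u 𝓤]
  | succ n ih =>
    intro p hp hcard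
    have hex : ∃ e, p e ≠ 0 ∧ p e ≠ 1 := by
      have hpos : 0 < (Finset.univ.filter fun e => p e ≠ 0 ∧ p e ≠ 1).card := by
        rw [hcard]; exact Nat.succ_pos n
      obtain ⟨e, he⟩ := Finset.card_pos.1 hpos
      simp only [Finset.mem_filter, Finset.mem_univ, true_and] at he
      exact ⟨e, he⟩
    obtain ⟨f, hf0, hf1, hmin⟩ := huni p hp hex
    have hmem : f ∈ (Finset.univ.filter fun e => p e ≠ 0 ∧ p e ≠ 1) := by simp [hf0, hf1]
    have hcard' : ∀ c : R, c = 0 ∨ c = 1 →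
        (Finset.univ.filter fun e => Function.update p f c e ≠ 0 ∧
          Function.update p f c e ≠ 1).card = n := by
      intro c hc
      rw [psiPin_filter_unpinned_update p f c hc, Finset.card_erase_of_mem hmem, hcard]
      rfl
    have h0 := ih (Function.update p f 0) (hp.update f le_rfl zero_le_one) (hcard' 0 (Or.inl rfl))
    have h1 := ih (Function.update p f 1) (hp.update f zero_le_one le_rfl) (hcard' 1 (Or.inr rfl))
    exact le_trans (le_min h0 h1) hmin

end PinInduction

end Summit.Ventures.PercRepro2
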